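import Summits.QuantumFields.BalabanUV.Beta.GAN24.CombFaceWordSockets

/-!
# `BalabanUV.Beta.GAN24.CombFaceWordCellPairing` — binder row G-an2-4 ∕ (CONV-C), TRANSFER-III, the (III′) (C)-row's `hXF (l+1)` FACE TERMS (OWNER gan24-p1 g53's memo
# `M3-HXF-SIZING-g53.md` §1): **THE DEEP-PERIOD FINE FACE WORD OF THE TRANSPORTED COMB TABLES THROUGH THE bm KERNEL IS THE CELL PAIRING OF THE UNTRANSPORTED COMB E-SECTOR's
# TWO-FACE CURRENTS — THE TRANSPORT `𝒯` DROPS OUT ENTIRELY**: at an1's record, every level `j+1`, every pattern `(μ,ν;α,β)`, every period `Lc·N`, all pins and units,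
# `Σ_{rr∈box(Lc·N)} Σ'_t 𝟙𝟙·Σ'_{(y,w)} 𝟙𝟙·((𝒯S̃′_{j+1} μ rr ∘ X̃_{j+1}) ∘ 𝒯S̃′_{j+1} ν t)(y,w)(inl α)(inl β) = Σ_{x∈box(Lc·N)} Σ_a FF_L[S^E_j](a,x)·Σ'_z Σ_b X̃_{j+1}(x,z)_{ab}·FF_R[S^E_j](b,z)`,
# `S^E_j := unitS (cE·wE_{j+1} • e3OfK Lc G_j (𝒯 S̃comb_j))` — EXACTLY the INPUT SHAPE of my C `CombFaceWordEEValueDeep.cellPairing_deep_value_units` (the eight `hD ∕ hS` values of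
# leaf-06's adapter `crossed_faceRead_of_values` at the comb data are therefore C's closed forms); and the level-`0` twin with the Wilson table `cE • wilsonA`, whose cell pairing is
# leaf-06's `FaceWordEEValueZero.cellPairing_zero_value_units` BY NAME at the root `ctrOff (d+1) Lc`.
# (G-an2-4 CRUX TEAM (2), leaf prover `b2b-balaban-gan24-formalise-leaf-01`, gen 88; journal [LEAF01-G88-INTENT-4])

THE MECHANISM ([folklore] BY NAME).  F6 `CombForcingSectorSplit.transport_SpureCombOf_succ ∕ _zero` + F3 `transport_unitS` + `unitS_add`: `𝒯S̃′ = 𝒯S^E + 𝒯S^V`; leaf-06's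
`FaceWordNullSector.faceWord_eq_cellPairing_of_null` with `S₁ = 𝒯S^E` (field legs only: `Ψ̂`'s mixed blocks vanish) and `S₂ = 𝒯S^V` whose two-face currents are NULL — my A
`SymFaceDataVHNull` for the untransported symmetrised border, carried through `𝒯` by my D1 `TransportedMixedLegCurrents` §3 (the border is leg-symmetric); then the two currents of `𝒯S^E`
ARE those of `S^E`: the right one by g87 L `exitRow_current_transport_eq_of_divFree` with (D)_comb = g87 K `divFree_e3OfK_transport_ScombOf` (the face indicator of period `Lc·N` is the class
datum `(Lc·N)⁻¹ + dΦ`, leaf-04's `face_eq_class`), the left one through the leg antisymmetry of the cubic sector (leaf-01 g86 C `sector_antisymm`, A1 `unitS_antisymm`, D1 `transport_antisymm`).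
HONEST FRAMING (cell contract, verbatim): «discharging `BetaPertH` makes Bałaban's UV stability UNCONDITIONAL — a real constructive-QFT result; it is NOT the continuum limit and NOT the
Clay problem.»  HONEST DEPENDENCY (verbatim): «continuum YM on T⁴ ⇐ BetaPertH ∧ nine spine estimates (0/9 proved); BetaPertH ⇐ (D1) ∧ (D4) ∧ CAP+tail; G-an2-4 gates asym, D1 and NE2/3/4.»

WHAT ([folklore]; `[NeZero Lc]`, `[NeZero N]`, an1's record `symTablesAn1S2 d Lc cΛt`, all `cE cVH cΛ sf sm`; 0 `def`, 0 cited fact, 0 `def … : Prop`, 0 sorry; sockets in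
`CombFaceWordSockets`): §1 **`faceWord_comb_succ_eq_cellPairing`** (level `j+1`, every pattern `(μ,ν;α,β)`, every period `Lc·N`); §2 `divFree_wilson_units`,
`faceCurrent_transport_wilson_eq`, **`faceWord_comb_zero_eq_cellPairing`** (level `0`).  Asserts NO value of Bałaban's tables; NEVER
«G-an2-4 closed» as (CONV-C); NOT D1, NOT `BetaPertH`, NOT continuum, NOT Clay.  2026-08-27; no existing file touched.
-/

noncomputable section

open Finset
open scoped BigOperators
open Literature.MathematicalPhysics.QuantumFieldTheory
open Literature.MathematicalPhysics.QuantumFieldTheory.Balaban1983to89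
open Literature.MathematicalPhysics.QuantumFieldTheory.Balaban1983to89.Beta
open ExpKernelCalculus (Site MKer Decays comp shiftK)
open OneStepResolventKernel (Fib LocStencil)
open OneStepKernelFamily (KInvStep shiftK_KInvStep)
open AffineAveraging (box toSite unitVec)
open AveragingContoursRooted (ctr ctrOff ctrOff_mem_box)
open StepJetData (wilsonA wilsonA_antisymm locStencil_wilsonA locStencil_smul)
open BalabanStepJetsSucc (wE wVH)
open Summit.QuantumFields.BalabanUV.Beta.TameKernelCalculus (trK)
open Summit.QuantumFields.BalabanUV.Beta.BorderedHessian (sgnK)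
open Summit.QuantumFields.BalabanUV.Beta.AxialDressingRooted (coDressKBmAt decays_coDressKBmAt_KInvStep shiftK_coDressKBmAt one_le_of_neZero)
open Summit.QuantumFields.BalabanUV.Beta.HessKerDressedUnits (unitK unitS unitS_apply locStencil_unitS decays_unitK)
open Summit.QuantumFields.BalabanUV.Beta.SpineRooted (e3OfK)
open Summit.QuantumFields.BalabanUV.Beta.SymAveragingHessianCounts (symVhSAt symVhSAt_symm)
open Summit.QuantumFields.BalabanUV.Beta.SymSecondOrderTablesAn1 (symTablesAn1S2)
open Summit.QuantumFields.BalabanUV.Beta.CombChartStepJets (ScombOf SpureCombOf)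
open Summit.QuantumFields.BalabanUV.Beta.SymCorrectorKernel (psiKS)
open Summit.QuantumFields.BalabanUV.Beta.SymCorrectorFace (slotPsiS b6unitVec_eq)
open Summit.QuantumFields.BalabanUV.Beta.SymCorrectorSlot (comp_psiKS_inr_right comp_trK_psiKS_inr_left)
open Summit.QuantumFields.BalabanUV.Beta.GAN24.CombCubicStepTransport (locStencil_transportPsiS)
open Summit.QuantumFields.BalabanUV.Beta.GAN24.CombForcingTwoFaceWords (exists_locStencil_transport_S)
open Summit.QuantumFields.BalabanUV.Beta.GAN24.CombTransportedBorder (transport_unitS slotPsiS_entry_eq_zero locStencil_symVhS)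
open Summit.QuantumFields.BalabanUV.Beta.GAN24.CombWWordZero (transportS_unitS_translate)
open Summit.QuantumFields.BalabanUV.Beta.GAN24.CombForcingSectorSplit (transport_SpureCombOf_succ transport_SpureCombOf_zero)
open Summit.QuantumFields.BalabanUV.Beta.GAN24.CombVHEWordsZeroStep (sector_inr_left sector_inr_right sector_antisymm exists_locStencil_sector exists_locStencil_transport_ScombOf
  parityOdd_transport_ScombOf)
open Summit.QuantumFields.BalabanUV.Beta.GAN24.CombExitFaceCurrentDivFree (divFree_e3OfK_transport_ScombOf)
open Summit.QuantumFields.BalabanUV.Beta.GAN24.ExitFaceCurrentDivFree (face_eq_class abs_facePot_le unitS_smul_inl_inl)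
open Summit.QuantumFields.BalabanUV.Beta.GAN24.WilsonCurrentBoxForm (divFree_wilson_current)
open Summit.QuantumFields.BalabanUV.Beta.GAN24.StencilSlotOfShapes (unitS_add)
open Summit.QuantumFields.BalabanUV.Beta.GAN24.FaceWordVHNullCurrents (emod_face_of_dvd)
open Summit.QuantumFields.BalabanUV.Beta.GAN24.FaceWordNullSector (faceWord_eq_cellPairing_of_null)
open Summit.QuantumFields.BalabanUV.Beta.GAN24.ExitFaceWeightTransport (exitRow_current_transport_eq_of_divFree)
open Summit.QuantumFields.BalabanUV.Beta.GAN24.TransportedWordTools (unitS_antisymm)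
open Summit.QuantumFields.BalabanUV.Beta.GAN24.TransportedMixedLegCurrents (transport_antisymm exitRow_current_transport_eq_zero_fst exitRow_current_transport_eq_zero_snd)
open Summit.QuantumFields.BalabanUV.Beta.GAN24.SymFaceDataVHNull (symVhSAt_faceData_eq_zero')

open Summit.QuantumFields.BalabanUV.Beta.GAN24.CombFaceWordSockets (exitInd_bdd_supp transport_noMul transport_symVhS_null faceCurrent_transport_sector_eq
  faceCurrent_transport_sector_eq_fst divFree_sector_comb)

namespace Summit.QuantumFields.BalabanUV.Beta.GAN24.CombFaceWordCellPairing

variable {d : ℕ} {Lc : ℕ} [NeZero Lc]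

/-! ## §1 Level `j+1`: the cubic sector -/

/-- NOT IN PRINT; OUR BOOKKEEPING ([folklore]; THE LEVEL-`(j+1)` CELL PAIRING AT THE COMB DATA).  For an1's record `symTablesAn1S2 d Lc cΛt`, all pins `cE cVH cΛ`, all units, every level `j`,
every period `Lc·N` and every pattern `(μ,ν;α,β)`: the direct fine face word of `(𝒯S̃′_{j+1}, X̃_{j+1})` — leaf-06's adapter `hD` shape at the comb data — IS the cell pairing of the two-face
currents of the UNTRANSPORTED E-sector `S^E_j = unitS ((cE·wE_{j+1}) • e3OfK Lc G_j (𝒯 S̃comb_j))` through `X̃_{j+1}` — my C `cellPairing_deep_value_units`' input shape. -/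
theorem faceWord_comb_succ_eq_cellPairing (cΛt sf sm cE cVH cΛ : ℝ) (j N : ℕ) [NeZero N] (μ ν α β : Fin (d + 1)) :
    ∑ rr ∈ box (d + 1) (Lc * N), ∑' t : Site (d + 1),
        (if toSite rr μ % ((Lc * N : ℕ) : ℤ) = ((Lc * N : ℕ) : ℤ) - 1 then (1 : ℝ) else 0) * (if t ν % ((Lc * N : ℕ) : ℤ) = ((Lc * N : ℕ) : ℤ) - 1 then (1 : ℝ) else 0) *
        ∑' yw : Site (d + 1) × Site (d + 1),
          (if yw.1 α % ((Lc * N : ℕ) : ℤ) = ((Lc * N : ℕ) : ℤ) - 1 then (1 : ℝ) else 0) * (if yw.2 β % ((Lc * N : ℕ) : ℤ) = ((Lc * N : ℕ) : ℤ) - 1 then (1 : ℝ) else 0) *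
          comp (comp
            ((fun κ u => comp (comp (trK (psiKS (ctrOff (d + 1) Lc) Lc)) (slotPsiS (ctrOff (d + 1) Lc) Lc (unitS sf sm (SpureCombOf (symTablesAn1S2 d Lc cΛt) cE cVH cΛ (j + 1))) κ u)) (psiKS (ctrOff (d + 1) Lc) Lc)) μ (toSite rr))
            (unitK sf sm (coDressKBmAt (toSite (ctrOff (d + 1) Lc)) Lc (KInvStep (d := d) Lc (j + 1)))))
            ((fun κ u => comp (comp (trK (psiKS (ctrOff (d + 1) Lc) Lc)) (slotPsiS (ctrOff (d + 1) Lc) Lc (unitS sf sm (SpureCombOf (symTablesAn1S2 d Lc cΛt) cE cVH cΛ (j + 1))) κ u)) (psiKS (ctrOff (d + 1) Lc) Lc)) ν t)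
            yw.1 yw.2 (Sum.inl α) (Sum.inl β) =
      ∑ x ∈ box (d + 1) (Lc * N), ∑ a : Fin (d + 1),
        (∑' y : Site (d + 1), (if y α % ((Lc * N : ℕ) : ℤ) = ((Lc * N : ℕ) : ℤ) - 1 then (1 : ℝ) else 0) *
          ∑' t : Site (d + 1), (if t μ % ((Lc * N : ℕ) : ℤ) = ((Lc * N : ℕ) : ℤ) - 1 then
            unitS sf sm (fun κ u => (cE * wE d Lc (j + 1)) • e3OfK Lc (coDressKBmAt (toSite (ctrOff (d + 1) Lc)) Lc (KInvStep (d := d) Lc j))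
              (fun κ u => comp (comp (trK (psiKS (ctrOff (d + 1) Lc) Lc)) (slotPsiS (ctrOff (d + 1) Lc) Lc (ScombOf (symTablesAn1S2 d Lc cΛt) cE cVH cΛ j) κ u)) (psiKS (ctrOff (d + 1) Lc) Lc)) κ u) μ t y (toSite x) (Sum.inl α) (Sum.inl a)
            else 0)) *
        (∑' z : Site (d + 1), ∑ b : Fin (d + 1), unitK sf sm (coDressKBmAt (toSite (ctrOff (d + 1) Lc)) Lc (KInvStep (d := d) Lc (j + 1))) (toSite x) z (Sum.inl a) (Sum.inl b) *
          (∑' w : Site (d + 1), (if w β % ((Lc * N : ℕ) : ℤ) = ((Lc * N : ℕ) : ℤ) - 1 then (1 : ℝ) else 0) *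
            ∑' t : Site (d + 1), (if t ν % ((Lc * N : ℕ) : ℤ) = ((Lc * N : ℕ) : ℤ) - 1 then
              unitS sf sm (fun κ u => (cE * wE d Lc (j + 1)) • e3OfK Lc (coDressKBmAt (toSite (ctrOff (d + 1) Lc)) Lc (KInvStep (d := d) Lc j))
                (fun κ u => comp (comp (trK (psiKS (ctrOff (d + 1) Lc) Lc)) (slotPsiS (ctrOff (d + 1) Lc) Lc (ScombOf (symTablesAn1S2 d Lc cΛt) cE cVH cΛ j) κ u)) (psiKS (ctrOff (d + 1) Lc) Lc)) κ u) ν t z w (Sum.inl b) (Sum.inl β)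
              else 0))) := by
  classical
  haveI : NeZero (Lc * N) := ⟨Nat.mul_ne_zero (NeZero.ne Lc) (NeZero.ne N)⟩
  have hLc1 : 1 ≤ Lc := one_le_of_neZero Lc
  have hLc : 0 < Lc := hLc1
  have hr : ctrOff (d + 1) Lc ∈ box (d + 1) Lc := ctrOff_mem_box hLc
  -- the member and the two sectors
  obtain ⟨CM, δM, hδM, hM⟩ := exists_locStencil_transport_ScombOf (d := d) (Lc := Lc) cΛt cE cVH cΛ j
  have hMp := parityOdd_transport_ScombOf (d := d) (Lc := Lc) cΛt cE cVH cΛ j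
  obtain ⟨CE, δE, hδE, hE⟩ := exists_locStencil_sector hr (cE * wE d Lc (j + 1)) j hM hδM
  have hEu := locStencil_unitS (sf := sf) (sm := sm) hE
  have hV : LocStencil (unitS sf sm (fun κ u => (cVH * wVH d Lc (j + 1)) • symVhSAt (ctr (d + 1) Lc) d Lc rfl κ u)) _ δE :=
    locStencil_unitS (locStencil_symVhS (Lc := Lc) (cVH * wVH d Lc (j + 1)) hδE.le)
  obtain ⟨C₁, δ₁, hδ₁, hT₁⟩ := locStencil_transportPsiS hLc hr hEu hδE
  obtain ⟨C₂, δ₂, hδ₂, hT₂⟩ := locStencil_transportPsiS hLc hr hV hδE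
  obtain ⟨Cs, δs, hδs, hS⟩ := exists_locStencil_transport_S (symTablesAn1S2 d Lc cΛt) sf sm cE cVH cΛ (j + 1)
  obtain ⟨δK, CK, hδK, -, hG⟩ := decays_coDressKBmAt_KInvStep (d := d) (Lc := Lc) hr (j + 1)
  have hXu := decays_unitK (sf := sf) (sm := sm) hG
  -- one common rate
  set m : ℝ := min (min δs δK) (min δ₁ δ₂) with hm
  have hm0 : 0 < m := lt_min (lt_min hδs hδK) (lt_min hδ₁ hδ₂)
  have hSm := BalabanStepJets.locStencil_mono hS ((hS 0 0).nonneg (Sum.inl 0)) ((min_le_left _ _).trans (min_le_left _ _) : m ≤ δs)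
  have hXm := OneStepResolventKernel.decays_mono hXu (hXu.nonneg (Sum.inl 0)) le_rfl ((min_le_left _ _).trans (min_le_right _ _) : m ≤ δK)
  have hT₁m := BalabanStepJets.locStencil_mono hT₁ ((hT₁ 0 0).nonneg (Sum.inl 0)) ((min_le_right _ _).trans (min_le_left _ _) : m ≤ δ₁)
  have hT₂m := BalabanStepJets.locStencil_mono hT₂ ((hT₂ 0 0).nonneg (Sum.inl 0)) ((min_le_right _ _).trans (min_le_right _ _) : m ≤ δ₂)
  -- covariance at the period `Lc·N`
  have esmul : ∀ s : Site (d + 1), ((Lc * N : ℕ) : ℤ) • s = (Lc : ℤ) • ((N : ℤ) • s) := by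
    intro s; rw [smul_smul, Nat.cast_mul]
  have hSt : ∀ (κ : Fin (d + 1)) (t s : Site (d + 1)),
      (fun κ u => comp (comp (trK (psiKS (ctrOff (d + 1) Lc) Lc)) (slotPsiS (ctrOff (d + 1) Lc) Lc (unitS sf sm (SpureCombOf (symTablesAn1S2 d Lc cΛt) cE cVH cΛ (j + 1))) κ u)) (psiKS (ctrOff (d + 1) Lc) Lc)) κ (t + ((Lc * N : ℕ) : ℤ) • s)
        = shiftK (-(((Lc * N : ℕ) : ℤ) • s)) ((fun κ u => comp (comp (trK (psiKS (ctrOff (d + 1) Lc) Lc)) (slotPsiS (ctrOff (d + 1) Lc) Lc (unitS sf sm (SpureCombOf (symTablesAn1S2 d Lc cΛt) cE cVH cΛ (j + 1))) κ u)) (psiKS (ctrOff (d + 1) Lc) Lc)) κ t) := by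
    intro κ t s
    rw [esmul]
    exact transportS_unitS_translate (symTablesAn1S2 d Lc cΛt) sf sm cE cVH cΛ (j + 1) κ t ((N : ℤ) • s)
  have hXt : ∀ s : Site (d + 1), shiftK (-(((Lc * N : ℕ) : ℤ) • s)) (unitK sf sm (coDressKBmAt (toSite (ctrOff (d + 1) Lc)) Lc (KInvStep (d := d) Lc (j + 1))))
      = unitK sf sm (coDressKBmAt (toSite (ctrOff (d + 1) Lc)) Lc (KInvStep (d := d) Lc (j + 1))) := by
    intro s
    rw [esmul]
    show unitK sf sm (shiftK (-((Lc : ℤ) • ((N : ℤ) • s))) (coDressKBmAt (toSite (ctrOff (d + 1) Lc)) Lc (KInvStep (d := d) Lc (j + 1)))) = _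
    rw [shiftK_coDressKBmAt (toSite (ctrOff (d + 1) Lc)) hLc1 (shiftK_KInvStep (d := d) (Lc := Lc) (j + 1)) ((N : ℤ) • s)]
  -- the sector split
  have hsplit : ∀ (κ : Fin (d + 1)) (t : Site (d + 1)),
      (fun κ u => comp (comp (trK (psiKS (ctrOff (d + 1) Lc) Lc)) (slotPsiS (ctrOff (d + 1) Lc) Lc (unitS sf sm (SpureCombOf (symTablesAn1S2 d Lc cΛt) cE cVH cΛ (j + 1))) κ u)) (psiKS (ctrOff (d + 1) Lc) Lc)) κ t
        = (fun κ u => comp (comp (trK (psiKS (ctrOff (d + 1) Lc) Lc)) (slotPsiS (ctrOff (d + 1) Lc) Lc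
            (unitS sf sm (fun κ t => (cE * wE d Lc (j + 1)) • e3OfK Lc (coDressKBmAt (toSite (ctrOff (d + 1) Lc)) Lc (KInvStep (d := d) Lc j))
              (fun κ u => comp (comp (trK (psiKS (ctrOff (d + 1) Lc) Lc)) (slotPsiS (ctrOff (d + 1) Lc) Lc (ScombOf (symTablesAn1S2 d Lc cΛt) cE cVH cΛ j) κ u)) (psiKS (ctrOff (d + 1) Lc) Lc)) κ t)) κ u)) (psiKS (ctrOff (d + 1) Lc) Lc)) κ t
          + (fun κ u => comp (comp (trK (psiKS (ctrOff (d + 1) Lc) Lc)) (slotPsiS (ctrOff (d + 1) Lc) Lc (unitS sf sm (fun κ u => (cVH * wVH d Lc (j + 1)) • symVhSAt (ctr (d + 1) Lc) d Lc rfl κ u)) κ u))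
            (psiKS (ctrOff (d + 1) Lc) Lc)) κ t := by
    intro κ t
    have HS : (fun κ u => comp (comp (trK (psiKS (ctrOff (d + 1) Lc) Lc)) (slotPsiS (ctrOff (d + 1) Lc) Lc (unitS sf sm (SpureCombOf (symTablesAn1S2 d Lc cΛt) cE cVH cΛ (j + 1))) κ u)) (psiKS (ctrOff (d + 1) Lc) Lc))
        = fun κ u => (fun κ u => comp (comp (trK (psiKS (ctrOff (d + 1) Lc) Lc)) (slotPsiS (ctrOff (d + 1) Lc) Lc
            (unitS sf sm (fun κ t => (cE * wE d Lc (j + 1)) • e3OfK Lc (coDressKBmAt (toSite (ctrOff (d + 1) Lc)) Lc (KInvStep (d := d) Lc j))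
              (fun κ u => comp (comp (trK (psiKS (ctrOff (d + 1) Lc) Lc)) (slotPsiS (ctrOff (d + 1) Lc) Lc (ScombOf (symTablesAn1S2 d Lc cΛt) cE cVH cΛ j) κ u)) (psiKS (ctrOff (d + 1) Lc) Lc)) κ t)) κ u)) (psiKS (ctrOff (d + 1) Lc) Lc)) κ u
          + (fun κ u => comp (comp (trK (psiKS (ctrOff (d + 1) Lc) Lc)) (slotPsiS (ctrOff (d + 1) Lc) Lc (unitS sf sm (fun κ u => (cVH * wVH d Lc (j + 1)) • symVhSAt (ctr (d + 1) Lc) d Lc rfl κ u)) κ u))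
            (psiKS (ctrOff (d + 1) Lc) Lc)) κ u := by
      rw [transport_unitS, transport_unitS, transport_unitS]
      have e2 : (fun κ u => comp (comp (trK (psiKS (ctrOff (d + 1) Lc) Lc)) (slotPsiS (ctrOff (d + 1) Lc) Lc (SpureCombOf (symTablesAn1S2 d Lc cΛt) cE cVH cΛ (j + 1)) κ u)) (psiKS (ctrOff (d + 1) Lc) Lc))
          = fun κ u =>
            comp (comp (trK (psiKS (ctrOff (d + 1) Lc) Lc)) (slotPsiS (ctrOff (d + 1) Lc) Lc
              (fun κ u => (cE * wE d Lc (j + 1)) • e3OfK Lc (coDressKBmAt (toSite (ctrOff (d + 1) Lc)) Lc (KInvStep (d := d) Lc j))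
                (fun κ u => comp (comp (trK (psiKS (ctrOff (d + 1) Lc) Lc)) (slotPsiS (ctrOff (d + 1) Lc) Lc (ScombOf (symTablesAn1S2 d Lc cΛt) cE cVH cΛ j) κ u)) (psiKS (ctrOff (d + 1) Lc) Lc)) κ u) κ u))
              (psiKS (ctrOff (d + 1) Lc) Lc)
            + comp (comp (trK (psiKS (ctrOff (d + 1) Lc) Lc)) (slotPsiS (ctrOff (d + 1) Lc) Lc (fun κ u => (cVH * wVH d Lc (j + 1)) • symVhSAt (ctr (d + 1) Lc) d Lc rfl κ u) κ u)) (psiKS (ctrOff (d + 1) Lc) Lc) :=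
        transport_SpureCombOf_succ (symTablesAn1S2 d Lc cΛt) cE cVH cΛ j
      rw [e2, ← unitS_add]
    exact congrFun (congrFun HS κ) t
  -- `S₁` has field legs only; `S₂` has null currents
  have hl0 : ∀ (κ : Fin (d + 1)) (t y x : Site (d + 1)) (m' : Fin (d + 1)) (b : Fib d),
      ((cE * wE d Lc (j + 1)) • e3OfK Lc (coDressKBmAt (toSite (ctrOff (d + 1) Lc)) Lc (KInvStep (d := d) Lc j))
        (fun κ u => comp (comp (trK (psiKS (ctrOff (d + 1) Lc) Lc)) (slotPsiS (ctrOff (d + 1) Lc) Lc (ScombOf (symTablesAn1S2 d Lc cΛt) cE cVH cΛ j) κ u)) (psiKS (ctrOff (d + 1) Lc) Lc)) κ t)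
        y x (Sum.inr m') b = 0 := fun κ t y x m' b => sector_inr_left (rb := ctrOff (d + 1) Lc) (cE * wE d Lc (j + 1)) j κ t y x m' b
  have hr0 : ∀ (κ : Fin (d + 1)) (t y x : Site (d + 1)) (a : Fib d) (m' : Fin (d + 1)),
      ((cE * wE d Lc (j + 1)) • e3OfK Lc (coDressKBmAt (toSite (ctrOff (d + 1) Lc)) Lc (KInvStep (d := d) Lc j))
        (fun κ u => comp (comp (trK (psiKS (ctrOff (d + 1) Lc) Lc)) (slotPsiS (ctrOff (d + 1) Lc) Lc (ScombOf (symTablesAn1S2 d Lc cΛt) cE cVH cΛ j) κ u)) (psiKS (ctrOff (d + 1) Lc) Lc)) κ t)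
        y x a (Sum.inr m') = 0 := fun κ t y x a m' => sector_inr_right (rb := ctrOff (d + 1) Lc) (cE * wE d Lc (j + 1)) j κ t y x a m'
  have hnoMul := fun (κ : Fin (d + 1)) (t y x : Site (d + 1)) (m' : Fin (d + 1)) (b : Fib d) =>
    transport_noMul (Lc := Lc) (S := unitS sf sm (fun κ t => (cE * wE d Lc (j + 1)) • e3OfK Lc (coDressKBmAt (toSite (ctrOff (d + 1) Lc)) Lc (KInvStep (d := d) Lc j))
      (fun κ u => comp (comp (trK (psiKS (ctrOff (d + 1) Lc) Lc)) (slotPsiS (ctrOff (d + 1) Lc) Lc (ScombOf (symTablesAn1S2 d Lc cΛt) cE cVH cΛ j) κ u)) (psiKS (ctrOff (d + 1) Lc) Lc)) κ t))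
      (fun κ t y x m' b => by rw [unitS_apply, hl0, mul_zero, zero_mul, mul_zero])
      (fun κ t y x a m' => by rw [unitS_apply, hr0, mul_zero, zero_mul, mul_zero]) κ t y x m' b
  obtain ⟨hnullL, hnullR⟩ := transport_symVhS_null (d := d) (Lc := Lc) sf sm (cVH * wVH d Lc (j + 1)) N μ α
  obtain ⟨-, hnullR'⟩ := transport_symVhS_null (d := d) (Lc := Lc) sf sm (cVH * wVH d Lc (j + 1)) N ν β
  rw [faceWord_eq_cellPairing_of_null (N := Lc * N) hSm hT₁m hT₂m hXm hm0 hSt hXt hsplit (fun κ t y x m' b => (hnoMul κ t y x m' b).1) (fun κ t y x a m' => (hnoMul κ t y x m' a).2)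
    μ ν α β hnullL hnullR']
  -- the transport drops from both E-sector currents
  refine Finset.sum_congr rfl fun x _ => Finset.sum_congr rfl fun a _ => ?_
  rw [faceCurrent_transport_sector_eq_fst sf sm (cE * wE d Lc (j + 1)) j N hM hδM hMp μ α (fun x => divFree_sector_comb cΛt sf sm (cE * wE d Lc (j + 1)) cE cVH cΛ j N μ α x) a (toSite x)]
  congr 1
  refine tsum_congr fun z => Finset.sum_congr rfl fun b _ => ?_
  rw [faceCurrent_transport_sector_eq sf sm (cE * wE d Lc (j + 1)) j N hM hδM ν β (fun x => divFree_sector_comb cΛt sf sm (cE * wE d Lc (j + 1)) cE cVH cΛ j N ν β x) b z]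

/-! ## §2 Level `0`: the Wilson table -/

omit [NeZero Lc] in
/-- [folklore] **THE LEVEL-`0` E-SECTOR `unitS (cE • wilsonA)` HAS FIRST-LEG DIVERGENCE-FREE EXIT-FACE CURRENTS** in g87 L's currency, every period, any weights' normalisation (leaf-04's
`WilsonCurrentBoxForm.divFree_wilson_current`, the units a constant). -/
theorem divFree_wilson_units (sf sm cE : ℝ) (N : ℕ) (ν β : Fin (d + 1)) (x : Site (d + 1)) :
    ∑ κ : Fin (d + 1),
      ((∑' q : Site (d + 1), (if q β % ((Lc * N : ℕ) : ℤ) = ((Lc * N : ℕ) : ℤ) - 1 then (1 : ℝ) else 0) * ∑' u : Site (d + 1), (if u ν % ((Lc * N : ℕ) : ℤ) = ((Lc * N : ℕ) : ℤ) - 1 then (1 : ℝ) else 0) * unitS sf sm (fun κ u => cE • wilsonA d κ u) ν u (x - unitVec κ) q (Sum.inl κ) (Sum.inl β))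
        - ∑' q : Site (d + 1), (if q β % ((Lc * N : ℕ) : ℤ) = ((Lc * N : ℕ) : ℤ) - 1 then (1 : ℝ) else 0) * ∑' u : Site (d + 1), (if u ν % ((Lc * N : ℕ) : ℤ) = ((Lc * N : ℕ) : ℤ) - 1 then (1 : ℝ) else 0) * unitS sf sm (fun κ u => cE • wilsonA d κ u) ν u x q (Sum.inl κ) (Sum.inl β)) = 0 := by
  have key := divFree_wilson_current (d := d) ν β (fun k : ℤ => if k % ((Lc * N : ℕ) : ℤ) = ((Lc * N : ℕ) : ℤ) - 1 then (1 : ℝ) else 0) (fun k : ℤ => if k % ((Lc * N : ℕ) : ℤ) = ((Lc * N : ℕ) : ℤ) - 1 then (1 : ℝ) else 0) x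
  simp only [b6unitVec_eq] at key
  have hin : ∀ (y q : Site (d + 1)) (κ : Fin (d + 1)), (∑' u : Site (d + 1), (if u ν % ((Lc * N : ℕ) : ℤ) = ((Lc * N : ℕ) : ℤ) - 1 then (1 : ℝ) else 0) * unitS sf sm (fun κ u => cE • wilsonA d κ u) ν u y q (Sum.inl κ) (Sum.inl β)) =
      ((sf * sm)⁻¹ * (sf⁻¹ * sf⁻¹ * cE)) * ∑' u : Site (d + 1), (if u ν % ((Lc * N : ℕ) : ℤ) = ((Lc * N : ℕ) : ℤ) - 1 then (1 : ℝ) else 0) * wilsonA d ν u y q (Sum.inl κ) (Sum.inl β) := by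
    intro y q κ
    rw [← tsum_mul_left]
    refine tsum_congr fun u => ?_
    rw [unitS_smul_inl_inl]
    ring
  have hout : ∀ (y : Site (d + 1)) (κ : Fin (d + 1)), (∑' q : Site (d + 1), (if q β % ((Lc * N : ℕ) : ℤ) = ((Lc * N : ℕ) : ℤ) - 1 then (1 : ℝ) else 0) * ∑' u : Site (d + 1), (if u ν % ((Lc * N : ℕ) : ℤ) = ((Lc * N : ℕ) : ℤ) - 1 then (1 : ℝ) else 0) * unitS sf sm (fun κ u => cE • wilsonA d κ u) ν u y q (Sum.inl κ) (Sum.inl β)) =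
      ((sf * sm)⁻¹ * (sf⁻¹ * sf⁻¹ * cE)) * ∑' q : Site (d + 1), (if q β % ((Lc * N : ℕ) : ℤ) = ((Lc * N : ℕ) : ℤ) - 1 then (1 : ℝ) else 0) * ∑' u : Site (d + 1), (if u ν % ((Lc * N : ℕ) : ℤ) = ((Lc * N : ℕ) : ℤ) - 1 then (1 : ℝ) else 0) * wilsonA d ν u y q (Sum.inl κ) (Sum.inl β) := by
    intro y κ
    simp_rw [hin]
    rw [← tsum_mul_left]
    exact tsum_congr fun q => by ring
  simp_rw [hout, ← mul_sub, ← Finset.mul_sum]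
  refine mul_eq_zero_of_right _ ?_
  rw [← neg_eq_zero, ← Finset.sum_neg_distrib]
  simpa only [neg_sub] using key

/-- [folklore] **THE TWO-FACE CURRENTS OF THE TRANSPORTED WILSON TABLE ARE THOSE OF THE WILSON TABLE** (free first leg: g87 L §3 with `divFree_wilson_units`; free second leg: through the
leg antisymmetry of `wilsonA` (an2's `StepJetData.wilsonA_antisymm`) and of its transport (D1 `transport_antisymm`)). -/
theorem faceCurrent_transport_wilson_eq (sf sm cE : ℝ) (N : ℕ) (ν β : Fin (d + 1)) (b : Fin (d + 1)) (z : Site (d + 1)) (μ α : Fin (d + 1)) (a : Fin (d + 1)) (x : Site (d + 1)) :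
    ((∑' w : Site (d + 1), (if w β % ((Lc * N : ℕ) : ℤ) = ((Lc * N : ℕ) : ℤ) - 1 then (1 : ℝ) else 0) * ∑' t : Site (d + 1), (if t ν % ((Lc * N : ℕ) : ℤ) = ((Lc * N : ℕ) : ℤ) - 1 then (fun κ u => comp (comp (trK (psiKS (ctrOff (d + 1) Lc) Lc)) (slotPsiS (ctrOff (d + 1) Lc) Lc (unitS sf sm (fun κ u => cE • wilsonA d κ u)) κ u)) (psiKS (ctrOff (d + 1) Lc) Lc)) ν t z w (Sum.inl b) (Sum.inl β) else 0)) =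
      ∑' w : Site (d + 1), (if w β % ((Lc * N : ℕ) : ℤ) = ((Lc * N : ℕ) : ℤ) - 1 then (1 : ℝ) else 0) * ∑' t : Site (d + 1), (if t ν % ((Lc * N : ℕ) : ℤ) = ((Lc * N : ℕ) : ℤ) - 1 then unitS sf sm (fun κ u => cE • wilsonA d κ u) ν t z w (Sum.inl b) (Sum.inl β) else 0)) ∧
    ((∑' y : Site (d + 1), (if y α % ((Lc * N : ℕ) : ℤ) = ((Lc * N : ℕ) : ℤ) - 1 then (1 : ℝ) else 0) * ∑' t : Site (d + 1), (if t μ % ((Lc * N : ℕ) : ℤ) = ((Lc * N : ℕ) : ℤ) - 1 then (fun κ u => comp (comp (trK (psiKS (ctrOff (d + 1) Lc) Lc)) (slotPsiS (ctrOff (d + 1) Lc) Lc (unitS sf sm (fun κ u => cE • wilsonA d κ u)) κ u)) (psiKS (ctrOff (d + 1) Lc) Lc)) μ t y x (Sum.inl α) (Sum.inl a) else 0)) =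
      ∑' y : Site (d + 1), (if y α % ((Lc * N : ℕ) : ℤ) = ((Lc * N : ℕ) : ℤ) - 1 then (1 : ℝ) else 0) * ∑' t : Site (d + 1), (if t μ % ((Lc * N : ℕ) : ℤ) = ((Lc * N : ℕ) : ℤ) - 1 then unitS sf sm (fun κ u => cE • wilsonA d κ u) μ t y x (Sum.inl α) (Sum.inl a) else 0)) := by
  have hLc1 : 1 ≤ Lc := one_le_of_neZero Lc
  have hLc : 0 < Lc := hLc1
  have hr : ctrOff (d + 1) Lc ∈ box (d + 1) Lc := ctrOff_mem_box hLc
  obtain ⟨hχb, hχs⟩ := exitInd_bdd_supp (Lc := Lc) hLc1 N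
  have hW : LocStencil (unitS sf sm (fun κ u => cE • wilsonA d κ u)) _ 1 := locStencil_unitS (locStencil_smul cE (locStencil_wilsonA (d := d) zero_le_one))
  have hanti := unitS_antisymm sf sm (S := fun κ u => cE • wilsonA d κ u) (fun κ u x z a b => by
    show (cE • wilsonA d κ u) z x b a = -((cE • wilsonA d κ u) x z a b)
    simp only [Pi.smul_apply, smul_eq_mul, wilsonA_antisymm κ u x z a b, mul_neg])
  have free : ∀ (ν β b : Fin (d + 1)) (z : Site (d + 1)),
      (∑' w : Site (d + 1), (if w β % ((Lc * N : ℕ) : ℤ) = ((Lc * N : ℕ) : ℤ) - 1 then (1 : ℝ) else 0) * ∑' t : Site (d + 1), (if t ν % ((Lc * N : ℕ) : ℤ) = ((Lc * N : ℕ) : ℤ) - 1 then (fun κ u => comp (comp (trK (psiKS (ctrOff (d + 1) Lc) Lc)) (slotPsiS (ctrOff (d + 1) Lc) Lc (unitS sf sm (fun κ u => cE • wilsonA d κ u)) κ u)) (psiKS (ctrOff (d + 1) Lc) Lc)) ν t z w (Sum.inl b) (Sum.inl β) else 0)) =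
      ∑' w : Site (d + 1), (if w β % ((Lc * N : ℕ) : ℤ) = ((Lc * N : ℕ) : ℤ) - 1 then (1 : ℝ) else 0) * ∑' t : Site (d + 1), (if t ν % ((Lc * N : ℕ) : ℤ) = ((Lc * N : ℕ) : ℤ) - 1 then unitS sf sm (fun κ u => cE • wilsonA d κ u) ν t z w (Sum.inl b) (Sum.inl β) else 0) := by
    intro ν β b z
    exact (tsum_congr fun w => by congr 1; exact tsum_congr fun t => by split_ifs <;> simp).trans
      ((exitRow_current_transport_eq_of_divFree hLc hr hW one_pos hχb hχb hχs hχs ν β (fun x => divFree_wilson_units (d := d) sf sm cE N ν β x) b z).trans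
        (tsum_congr fun w => by congr 1; exact tsum_congr fun t => by split_ifs <;> simp))
  refine ⟨free ν β b z, ?_⟩
  have hantiT := fun (t y : Site (d + 1)) => transport_antisymm hLc hr hW one_pos hanti μ t x y (Sum.inl a) (Sum.inl α)
  have eL : ∀ y : Site (d + 1), (∑' t : Site (d + 1), (if t μ % ((Lc * N : ℕ) : ℤ) = ((Lc * N : ℕ) : ℤ) - 1 then (fun κ u => comp (comp (trK (psiKS (ctrOff (d + 1) Lc) Lc)) (slotPsiS (ctrOff (d + 1) Lc) Lc (unitS sf sm (fun κ u => cE • wilsonA d κ u)) κ u)) (psiKS (ctrOff (d + 1) Lc) Lc)) μ t y x (Sum.inl α) (Sum.inl a) else 0)) =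
      -(∑' t : Site (d + 1), (if t μ % ((Lc * N : ℕ) : ℤ) = ((Lc * N : ℕ) : ℤ) - 1 then (fun κ u => comp (comp (trK (psiKS (ctrOff (d + 1) Lc) Lc)) (slotPsiS (ctrOff (d + 1) Lc) Lc (unitS sf sm (fun κ u => cE • wilsonA d κ u)) κ u)) (psiKS (ctrOff (d + 1) Lc) Lc)) μ t x y (Sum.inl a) (Sum.inl α) else 0)) := by
    intro y
    rw [← tsum_neg]
    refine tsum_congr fun t => ?_
    split_ifs
    · exact hantiT t y
    · rw [neg_zero]
  have eR : ∀ y : Site (d + 1), (∑' t : Site (d + 1), (if t μ % ((Lc * N : ℕ) : ℤ) = ((Lc * N : ℕ) : ℤ) - 1 then unitS sf sm (fun κ u => cE • wilsonA d κ u) μ t y x (Sum.inl α) (Sum.inl a) else 0)) =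
      -(∑' t : Site (d + 1), (if t μ % ((Lc * N : ℕ) : ℤ) = ((Lc * N : ℕ) : ℤ) - 1 then unitS sf sm (fun κ u => cE • wilsonA d κ u) μ t x y (Sum.inl a) (Sum.inl α) else 0)) := by
    intro y
    rw [← tsum_neg]
    refine tsum_congr fun t => ?_
    split_ifs
    · exact hanti μ t x y (Sum.inl a) (Sum.inl α)
    · rw [neg_zero]
  simp_rw [eL, eR, mul_neg, tsum_neg]
  rw [free μ α a x]

/-- NOT IN PRINT; OUR BOOKKEEPING ([folklore]; THE LEVEL-`0` CELL PAIRING AT THE COMB DATA).  For an1's record, all pins and units, every period `Lc·N`, every pattern: the direct fine face word of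
`(𝒯S̃′_0, X̃_0)` is the cell pairing of the two-face currents of the UNTRANSPORTED Wilson table `unitS (cE • wilsonA)` through `X̃_0` — leaf-06's `FaceWordEEValueZero.cellPairing_zero_value_units`'
INPUT SHAPE at the root `ctrOff (d+1) Lc`. -/
theorem faceWord_comb_zero_eq_cellPairing (cΛt sf sm cE cVH cΛ : ℝ) (N : ℕ) [NeZero N] (μ ν α β : Fin (d + 1)) :
    ∑ rr ∈ box (d + 1) (Lc * N), ∑' t : Site (d + 1),
        (if toSite rr μ % ((Lc * N : ℕ) : ℤ) = ((Lc * N : ℕ) : ℤ) - 1 then (1 : ℝ) else 0) * (if t ν % ((Lc * N : ℕ) : ℤ) = ((Lc * N : ℕ) : ℤ) - 1 then (1 : ℝ) else 0) *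
        ∑' yw : Site (d + 1) × Site (d + 1),
          (if yw.1 α % ((Lc * N : ℕ) : ℤ) = ((Lc * N : ℕ) : ℤ) - 1 then (1 : ℝ) else 0) * (if yw.2 β % ((Lc * N : ℕ) : ℤ) = ((Lc * N : ℕ) : ℤ) - 1 then (1 : ℝ) else 0) *
          comp (comp ((fun κ u => comp (comp (trK (psiKS (ctrOff (d + 1) Lc) Lc)) (slotPsiS (ctrOff (d + 1) Lc) Lc (unitS sf sm (SpureCombOf (symTablesAn1S2 d Lc cΛt) cE cVH cΛ 0)) κ u)) (psiKS (ctrOff (d + 1) Lc) Lc)) μ (toSite rr)) (unitK sf sm (coDressKBmAt (toSite (ctrOff (d + 1) Lc)) Lc (KInvStep (d := d) Lc 0)))) ((fun κ u => comp (comp (trK (psiKS (ctrOff (d + 1) Lc) Lc)) (slotPsiS (ctrOff (d + 1) Lc) Lc (unitS sf sm (SpureCombOf (symTablesAn1S2 d Lc cΛt) cE cVH cΛ 0)) κ u)) (psiKS (ctrOff (d + 1) Lc) Lc)) ν t) yw.1 yw.2 (Sum.inl α) (Sum.inl β) =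
      ∑ x ∈ box (d + 1) (Lc * N), ∑ a : Fin (d + 1),
        (∑' y : Site (d + 1), (if y α % ((Lc * N : ℕ) : ℤ) = ((Lc * N : ℕ) : ℤ) - 1 then (1 : ℝ) else 0) *
          ∑' t : Site (d + 1), (if t μ % ((Lc * N : ℕ) : ℤ) = ((Lc * N : ℕ) : ℤ) - 1 then unitS sf sm (fun κ u => cE • wilsonA d κ u) μ t y (toSite x) (Sum.inl α) (Sum.inl a) else 0)) *
        (∑' z : Site (d + 1), ∑ b : Fin (d + 1), unitK sf sm (coDressKBmAt (toSite (ctrOff (d + 1) Lc)) Lc (KInvStep (d := d) Lc 0)) (toSite x) z (Sum.inl a) (Sum.inl b) *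
          (∑' w : Site (d + 1), (if w β % ((Lc * N : ℕ) : ℤ) = ((Lc * N : ℕ) : ℤ) - 1 then (1 : ℝ) else 0) *
            ∑' t : Site (d + 1), (if t ν % ((Lc * N : ℕ) : ℤ) = ((Lc * N : ℕ) : ℤ) - 1 then unitS sf sm (fun κ u => cE • wilsonA d κ u) ν t z w (Sum.inl b) (Sum.inl β) else 0))) := by
  classical
  haveI : NeZero (Lc * N) := ⟨Nat.mul_ne_zero (NeZero.ne Lc) (NeZero.ne N)⟩
  have hLc1 : 1 ≤ Lc := one_le_of_neZero Lc
  have hLc : 0 < Lc := hLc1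
  have hr : ctrOff (d + 1) Lc ∈ box (d + 1) Lc := ctrOff_mem_box hLc
  have hW : LocStencil (unitS sf sm (fun κ u => cE • wilsonA d κ u)) _ 1 := locStencil_unitS (locStencil_smul cE (locStencil_wilsonA (d := d) zero_le_one))
  have hV : LocStencil (unitS sf sm (fun κ u => cVH • symVhSAt (ctr (d + 1) Lc) d Lc rfl κ u)) _ 1 := locStencil_unitS (locStencil_symVhS (Lc := Lc) cVH zero_le_one)
  obtain ⟨C₁, δ₁, hδ₁, hT₁⟩ := locStencil_transportPsiS hLc hr hW one_pos
  obtain ⟨C₂, δ₂, hδ₂, hT₂⟩ := locStencil_transportPsiS hLc hr hV one_pos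
  obtain ⟨Cs, δs, hδs, hS⟩ := exists_locStencil_transport_S (symTablesAn1S2 d Lc cΛt) sf sm cE cVH cΛ 0
  obtain ⟨δK, CK, hδK, -, hG⟩ := decays_coDressKBmAt_KInvStep (d := d) (Lc := Lc) hr 0
  have hXu := decays_unitK (sf := sf) (sm := sm) hG
  set m : ℝ := min (min δs δK) (min δ₁ δ₂) with hm
  have hm0 : 0 < m := lt_min (lt_min hδs hδK) (lt_min hδ₁ hδ₂)
  have hSm := BalabanStepJets.locStencil_mono hS ((hS 0 0).nonneg (Sum.inl 0)) ((min_le_left _ _).trans (min_le_left _ _) : m ≤ δs)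
  have hXm := OneStepResolventKernel.decays_mono hXu (hXu.nonneg (Sum.inl 0)) le_rfl ((min_le_left _ _).trans (min_le_right _ _) : m ≤ δK)
  have hT₁m := BalabanStepJets.locStencil_mono hT₁ ((hT₁ 0 0).nonneg (Sum.inl 0)) ((min_le_right _ _).trans (min_le_left _ _) : m ≤ δ₁)
  have hT₂m := BalabanStepJets.locStencil_mono hT₂ ((hT₂ 0 0).nonneg (Sum.inl 0)) ((min_le_right _ _).trans (min_le_right _ _) : m ≤ δ₂)
  have esmul : ∀ s : Site (d + 1), ((Lc * N : ℕ) : ℤ) • s = (Lc : ℤ) • ((N : ℤ) • s) := by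
    intro s; rw [smul_smul, Nat.cast_mul]
  have hSt : ∀ (κ : Fin (d + 1)) (t s : Site (d + 1)), (fun κ u => comp (comp (trK (psiKS (ctrOff (d + 1) Lc) Lc)) (slotPsiS (ctrOff (d + 1) Lc) Lc (unitS sf sm (SpureCombOf (symTablesAn1S2 d Lc cΛt) cE cVH cΛ 0)) κ u)) (psiKS (ctrOff (d + 1) Lc) Lc)) κ (t + ((Lc * N : ℕ) : ℤ) • s) = shiftK (-(((Lc * N : ℕ) : ℤ) • s)) ((fun κ u => comp (comp (trK (psiKS (ctrOff (d + 1) Lc) Lc)) (slotPsiS (ctrOff (d + 1) Lc) Lc (unitS sf sm (SpureCombOf (symTablesAn1S2 d Lc cΛt) cE cVH cΛ 0)) κ u)) (psiKS (ctrOff (d + 1) Lc) Lc)) κ t) := by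
    intro κ t s
    rw [esmul]
    exact transportS_unitS_translate (symTablesAn1S2 d Lc cΛt) sf sm cE cVH cΛ 0 κ t ((N : ℤ) • s)
  have hXt : ∀ s : Site (d + 1), shiftK (-(((Lc * N : ℕ) : ℤ) • s)) (unitK sf sm (coDressKBmAt (toSite (ctrOff (d + 1) Lc)) Lc (KInvStep (d := d) Lc 0))) = unitK sf sm (coDressKBmAt (toSite (ctrOff (d + 1) Lc)) Lc (KInvStep (d := d) Lc 0)) := by
    intro s
    rw [esmul]
    show unitK sf sm (shiftK (-((Lc : ℤ) • ((N : ℤ) • s))) (coDressKBmAt (toSite (ctrOff (d + 1) Lc)) Lc (KInvStep (d := d) Lc 0))) = _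
    rw [shiftK_coDressKBmAt (toSite (ctrOff (d + 1) Lc)) hLc1 (shiftK_KInvStep (d := d) (Lc := Lc) 0) ((N : ℤ) • s)]
  have hsplit : ∀ (κ : Fin (d + 1)) (t : Site (d + 1)), (fun κ u => comp (comp (trK (psiKS (ctrOff (d + 1) Lc) Lc)) (slotPsiS (ctrOff (d + 1) Lc) Lc (unitS sf sm (SpureCombOf (symTablesAn1S2 d Lc cΛt) cE cVH cΛ 0)) κ u)) (psiKS (ctrOff (d + 1) Lc) Lc)) κ t
        = (fun κ u => comp (comp (trK (psiKS (ctrOff (d + 1) Lc) Lc)) (slotPsiS (ctrOff (d + 1) Lc) Lc (unitS sf sm (fun κ u => cE • wilsonA d κ u)) κ u)) (psiKS (ctrOff (d + 1) Lc) Lc)) κ t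
          + (fun κ u => comp (comp (trK (psiKS (ctrOff (d + 1) Lc) Lc)) (slotPsiS (ctrOff (d + 1) Lc) Lc (unitS sf sm (fun κ u => cVH • symVhSAt (ctr (d + 1) Lc) d Lc rfl κ u)) κ u))
            (psiKS (ctrOff (d + 1) Lc) Lc)) κ t := by
    intro κ t
    have HS : (fun κ u => comp (comp (trK (psiKS (ctrOff (d + 1) Lc) Lc)) (slotPsiS (ctrOff (d + 1) Lc) Lc (unitS sf sm (SpureCombOf (symTablesAn1S2 d Lc cΛt) cE cVH cΛ 0)) κ u)) (psiKS (ctrOff (d + 1) Lc) Lc))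
        = fun κ u => (fun κ u => comp (comp (trK (psiKS (ctrOff (d + 1) Lc) Lc)) (slotPsiS (ctrOff (d + 1) Lc) Lc (unitS sf sm (fun κ u => cE • wilsonA d κ u)) κ u)) (psiKS (ctrOff (d + 1) Lc) Lc)) κ u
          + (fun κ u => comp (comp (trK (psiKS (ctrOff (d + 1) Lc) Lc)) (slotPsiS (ctrOff (d + 1) Lc) Lc (unitS sf sm (fun κ u => cVH • symVhSAt (ctr (d + 1) Lc) d Lc rfl κ u)) κ u))
            (psiKS (ctrOff (d + 1) Lc) Lc)) κ u := by
      rw [transport_unitS, transport_unitS, transport_unitS]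
      have e2 : (fun κ u => comp (comp (trK (psiKS (ctrOff (d + 1) Lc) Lc)) (slotPsiS (ctrOff (d + 1) Lc) Lc (SpureCombOf (symTablesAn1S2 d Lc cΛt) cE cVH cΛ 0) κ u)) (psiKS (ctrOff (d + 1) Lc) Lc))
          = fun κ u =>
            comp (comp (trK (psiKS (ctrOff (d + 1) Lc) Lc)) (slotPsiS (ctrOff (d + 1) Lc) Lc (fun κ u => cE • wilsonA d κ u) κ u)) (psiKS (ctrOff (d + 1) Lc) Lc)
            + comp (comp (trK (psiKS (ctrOff (d + 1) Lc) Lc)) (slotPsiS (ctrOff (d + 1) Lc) Lc (fun κ u => cVH • symVhSAt (ctr (d + 1) Lc) d Lc rfl κ u) κ u)) (psiKS (ctrOff (d + 1) Lc) Lc) :=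
        transport_SpureCombOf_zero (symTablesAn1S2 d Lc cΛt) cE cVH cΛ
      rw [e2, ← unitS_add]
    exact congrFun (congrFun HS κ) t
  have hl0 : ∀ (κ : Fin (d + 1)) (t y x : Site (d + 1)) (m' : Fin (d + 1)) (b : Fib d), (cE • wilsonA d κ t) y x (Sum.inr m') b = 0 := by
    intro κ t y x m' b
    rw [Pi.smul_apply, Pi.smul_apply, Pi.smul_apply, Pi.smul_apply]
    cases b <;> exact smul_zero _
  have hr0 : ∀ (κ : Fin (d + 1)) (t y x : Site (d + 1)) (a : Fib d) (m' : Fin (d + 1)), (cE • wilsonA d κ t) y x a (Sum.inr m') = 0 := by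
    intro κ t y x a m'
    rw [Pi.smul_apply, Pi.smul_apply, Pi.smul_apply, Pi.smul_apply]
    cases a <;> exact smul_zero _
  have hnoMul := fun (κ : Fin (d + 1)) (t y x : Site (d + 1)) (m' : Fin (d + 1)) (b : Fib d) =>
    transport_noMul (Lc := Lc) (S := unitS sf sm (fun κ u => cE • wilsonA d κ u))
      (fun κ t y x m' b => by rw [unitS_apply, hl0, mul_zero, zero_mul, mul_zero])
      (fun κ t y x a m' => by rw [unitS_apply, hr0, mul_zero, zero_mul, mul_zero]) κ t y x m' b
  obtain ⟨hnullL, -⟩ := transport_symVhS_null (d := d) (Lc := Lc) sf sm cVH N μ α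
  obtain ⟨-, hnullR'⟩ := transport_symVhS_null (d := d) (Lc := Lc) sf sm cVH N ν β
  rw [faceWord_eq_cellPairing_of_null (N := Lc * N) hSm hT₁m hT₂m hXm hm0 hSt hXt hsplit (fun κ t y x m' b => (hnoMul κ t y x m' b).1) (fun κ t y x a m' => (hnoMul κ t y x m' a).2)
    μ ν α β hnullL hnullR']
  refine Finset.sum_congr rfl fun x _ => Finset.sum_congr rfl fun a _ => ?_
  rw [(faceCurrent_transport_wilson_eq (d := d) (Lc := Lc) sf sm cE N ν β a (toSite x) μ α a (toSite x)).2]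
  congr 1
  refine tsum_congr fun z => Finset.sum_congr rfl fun b _ => ?_
  rw [(faceCurrent_transport_wilson_eq (d := d) (Lc := Lc) sf sm cE N ν β b z μ α a (toSite x)).1]

end Summit.QuantumFields.BalabanUV.Beta.GAN24.CombFaceWordCellPairing

end
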